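import Summits.AtomisticToContinuum.HydrodynamicLimit.Theses.ImplosionDichotomy
import Literature.MathematicalPhysics.KineticTheory.HardSphereEulerProofs
import Literature.Analysis.FunctionSpaces.TorusCalculusProofs
import Literature.Analysis.FunctionSpaces.TorusSpaceTime

/-!
# Energy is conserved along classical hard-sphere-Euler solutions with a smooth pressure field

Negative-side structure (tightness of witnesses) for the crux `ImplosionDichotomy.PolynomialCompression`
(stmt-AtomisticToContinuum-12587), from the standing disprover's `Cruxes/PolynomialCompression/Disproof.lean` §10
(cycle 3). Along a classical solution `IsHardSphereEulerSolution σ T ρ u θ` whose PRESSURE FIELD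
`(t,y) ↦ hsPressure σ (ρ t y) (θ t y) = ρθ Z(ρσ³)` is jointly smooth, the total energy `∫ E(t)`,
`E = ρ(|u|²/2 + 3θ/2)`, is constant on `[0,T)` (`integral_energy_eq`: energy equation + divergence theorem on `𝕋³` +
differentiation under `∫` + one-sided mean value theorem), so kinetic and internal energy are each bounded by
`∫ E(0)` at all times (`energy_budget`, using `ρ, θ > 0`). WHY THE HYPOTHESIS: the typed compressibility factor
`Z = hsCompressibility` is `deriv`-junk wherever the excess free energy is not differentiable, so before the route's
support `HsEosLowDensity` (stmt-0768: `Z` analytic near packing `0`) lands, the energy flux `(E + p)u` of a "classical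
solution" need not be differentiable and `Torus.divergence` of it is junk — energy conservation, like `∇p` in the
momentum equation, is the place where stmt-0768 is load-bearing for BOTH the provers and the disprover; MASS
conservation needs no such hypothesis (`DenseExcursionEverywhere.integral_density_eq`). For the crux: every witness
compresses to `σ^(-κ)` at σ-UNIFORMLY BOUNDED total energy (the admissible datum is pinned and bounded,
`Negative/PdeForm.lean`, `Negative/AtTimeZero.lean`). refuter-cdisprove-stmt-AtomisticToContinuum-12587-g3-0.
-/

noncomputable section

namespace Summit.AtomisticToContinuum.HydrodynamicLimit.Theorems

namespace PolynomialCompressionEnergy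

open MeasureTheory Filter Set Topology
open Literature.MathematicalPhysics.KineticTheory Literature.Analysis.FluidPDE
open Literature.Analysis.FunctionSpaces

/-- The total energy density of a classical solution is a jointly smooth space–time field. [folklore] -/
theorem isSmoothSpaceTimeOn_energy {σ T : ℝ} {ρ θ : ℝ → T3 → ℝ} {u : ℝ → T3 → V3}
    (hE : IsHardSphereEulerSolution σ T ρ u θ) :
    Torus.IsSmoothSpaceTimeOn (Ico 0 T) (fun s y => totalEnergyDensity (ρ s y) (u s y) (θ s y)) := by
  unfold totalEnergyDensity
  exact hE.smooth_density.mul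
    (((hE.smooth_velocity.norm_sq ℝ).div_const 2).add (contDiffOn_const.mul hE.smooth_temperature))

/-- **ENERGY IS CONSERVED** along a classical hard-sphere-Euler solution whose pressure field is jointly smooth:
`∫ E(t) = ∫ E(0)` for `t ∈ [0, T)`. [folklore] -/
theorem integral_energy_eq {σ T : ℝ} {ρ θ : ℝ → T3 → ℝ} {u : ℝ → T3 → V3} (hE : IsHardSphereEulerSolution σ T ρ u θ)
    (hp : Torus.IsSmoothSpaceTimeOn (Ico 0 T) (fun t y => hsPressure σ (ρ t y) (θ t y))) {t : ℝ} (ht : t ∈ Ico 0 T) :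
    ∫ x, totalEnergyDensity (ρ t x) (u t x) (θ t x) = ∫ x, totalEnergyDensity (ρ 0 x) (u 0 x) (θ 0 x) := by
  have hEn := isSmoothSpaceTimeOn_energy hE
  have hflux : Torus.IsSmoothSpaceTimeOn (Ico 0 T) (fun s y =>
      (totalEnergyDensity (ρ s y) (u s y) (θ s y) + hsPressure σ (ρ s y) (θ s y)) • u s y) :=
    (hEn.add hp).smul hE.smooth_velocity
  have hderiv : ∀ s ∈ Ico 0 T,
      HasDerivWithinAt (fun s => ∫ x, totalEnergyDensity (ρ s x) (u s x) (θ s x)) 0 (Ico 0 T) s := by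
    intro s hs
    have h1 := hEn.hasDerivWithinAt_integral (convex_Ico 0 T) hs
    have h2 : ∫ x, Torus.timeDerivWithin (Ico 0 T)
        (fun s y => totalEnergyDensity (ρ s y) (u s y) (θ s y)) s x = 0 := by
      have hpt : (fun x => Torus.timeDerivWithin (Ico 0 T)
            (fun s y => totalEnergyDensity (ρ s y) (u s y) (θ s y)) s x) =
          fun x => -Torus.divergence (fun y =>
            (totalEnergyDensity (ρ s y) (u s y) (θ s y) + hsPressure σ (ρ s y) (θ s y)) • u s y) x := by
        funext x; have := hE.energy s hs x; linarith
      rw [hpt, integral_neg, neg_eq_zero]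
      exact Torus.integral_divergence_eq_zero_holds (hflux.isSmooth_slice hs)
    rwa [h2] at h1
  have hcont : ContinuousOn (fun s => ∫ x, totalEnergyDensity (ρ s x) (u s x) (θ s x)) (Icc 0 t) := fun s hs =>
    ((hderiv s ⟨hs.1, hs.2.trans_lt ht.2⟩).continuousWithinAt).mono (Icc_subset_Ico_right ht.2)
  have hright : ∀ s ∈ Ico 0 t,
      HasDerivWithinAt (fun s => ∫ x, totalEnergyDensity (ρ s x) (u s x) (θ s x)) 0 (Ici s) s := by
    intro s hs
    have hsT : s ∈ Ico 0 T := ⟨hs.1, hs.2.trans ht.2⟩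
    refine (hderiv s hsT).mono_of_mem_nhdsWithin ?_
    exact Filter.mem_of_superset (Ico_mem_nhdsGE hsT.2) (Ico_subset_Ico_left hsT.1)
  exact constant_of_has_deriv_right_zero hcont hright t (right_mem_Icc.2 ht.1)

/-- **Energy budget**: along such a solution the kinetic energy `∫ ρ|u|²/2` and the internal energy `∫ (3/2)ρθ` at
every time are each bounded by the initial total energy (`ρ, θ > 0`). [folklore] -/
theorem energy_budget {σ T : ℝ} {ρ θ : ℝ → T3 → ℝ} {u : ℝ → T3 → V3} (hE : IsHardSphereEulerSolution σ T ρ u θ)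
    (hp : Torus.IsSmoothSpaceTimeOn (Ico 0 T) (fun t y => hsPressure σ (ρ t y) (θ t y))) {t : ℝ} (ht : t ∈ Ico 0 T) :
    ∫ x, ρ t x * (‖u t x‖ ^ 2 / 2) ≤ ∫ x, totalEnergyDensity (ρ 0 x) (u 0 x) (θ 0 x) ∧
    ∫ x, ρ t x * (3 / 2 * θ t x) ≤ ∫ x, totalEnergyDensity (ρ 0 x) (u 0 x) (θ 0 x) := by
  rw [← integral_energy_eq hE hp ht]
  have hρc : Continuous (ρ t) := (hE.smooth_density.isSmooth_slice ht).continuous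
  have huc : Continuous (u t) := (hE.smooth_velocity.isSmooth_slice ht).continuous
  have hθc : Continuous (θ t) := (hE.smooth_temperature.isSmooth_slice ht).continuous
  have hK : Integrable (fun x => ρ t x * (‖u t x‖ ^ 2 / 2)) volume :=
    integrable_of_continuous_T3 (hρc.mul ((huc.norm.pow 2).div_const 2))
  have hI : Integrable (fun x => ρ t x * (3 / 2 * θ t x)) volume :=
    integrable_of_continuous_T3 (hρc.mul (continuous_const.mul hθc))
  have hsum : ∫ x, totalEnergyDensity (ρ t x) (u t x) (θ t x) =
      (∫ x, ρ t x * (‖u t x‖ ^ 2 / 2)) + ∫ x, ρ t x * (3 / 2 * θ t x) := by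
    refine Eq.trans (integral_congr_ae (Eventually.of_forall fun x => ?_)) (integral_add hK hI)
    show totalEnergyDensity (ρ t x) (u t x) (θ t x) = ρ t x * (‖u t x‖ ^ 2 / 2) + ρ t x * (3 / 2 * θ t x)
    simp only [totalEnergyDensity]; ring
  have hKpos : 0 ≤ ∫ x, ρ t x * (‖u t x‖ ^ 2 / 2) :=
    integral_nonneg fun x => mul_nonneg (hE.density_pos t ht x).le (by positivity)
  have hIpos : 0 ≤ ∫ x, ρ t x * (3 / 2 * θ t x) :=
    integral_nonneg fun x => mul_nonneg (hE.density_pos t ht x).le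
      (mul_nonneg (by norm_num) (hE.temperature_pos t ht x).le)
  rw [hsum]
  exact ⟨le_add_of_nonneg_right hIpos, le_add_of_nonneg_left hKpos⟩

end PolynomialCompressionEnergy

end Summit.AtomisticToContinuum.HydrodynamicLimit.Theorems

end
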